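import Literature.Analysis.FluidPDE.ForwardDSSLocalEnergy
import Literature.Analysis.FunctionSpaces.WeakLimitLpBounds
import HarnessLib

/-!
# Forward DSS solutions: Bradshaw–Tsai 2019, Prop. 3.1 — the passage to the limit `ε → 0`

Analysis/FluidPDE fact file, third layer under the named fact
`Literature.Analysis.FluidPDE.bradshawTsai2019_prop_3_1` (Bradshaw–Tsai, Analysis & PDE 12
(2019) = arXiv:1801.08060, Proposition 3.1; files `ForwardDSSExistence`,
`ForwardDSSExistenceLocal`, `ForwardDSSLocalEnergy`). The accepted `ForwardDSSLocalEnergy.lean`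
reduced Prop. 3.1 to the single analytic input `bradshawTsai2019_prop_3_1_scheme`: the [BT1]
solution with its mollified approximants, the local energy estimate (3.12), the pressure bound,
and — clause (iv) — the statement that bounds obeyed by all approximants on `(0,T] × B₁` are
obeyed by the limit. In print (arXiv p. 10) clause (iv) is *derived* from the convergence
properties of the scheme quoted on p. 8 from [BT1]:

> "By the convergence properties of `u_ε(y,s)` to `u(y,s) = √t v(x,t)` [BT1] and discretely
> self-similar scaling (to extend the estimates down to `t = 0`), it follows that for all `T > 0`
> and all compact sets `K ⊂ ℝ³`, `v_ε → v` weakly in `L²(0,T;H¹(K))`, `v_ε → v` strongly in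
> `L²(0,T;L²(K))`, `v_ε(s) → v(s)` weakly in `L²(K)` for all `s ∈ [0,T]`." (p. 8)
>
> "Letting `ε → 0` yields `(v, χ_{B₁}v)(t) ≤ liminf_{ε→0} (v_ε, χ_{B₁}v_ε)_{L²}(t) ≤ 2α₀` for all
> `t ≤ T`. … From [BT1] we have that `v_ε` converges weakly to `v` in `L²(1/k,T;H¹(B₁))` for
> every `k ∈ ℕ`. Hence, `∫_{1/k}^T∫_{B₁}|∇v|² ≤ sup_{ε>0} ∫₀ᵀ∫_{B₁}|∇v_ε|²`, and, letting `k → ∞`, it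
> follows that `∫₀ᵀ∫_{B₁}|∇v|² ≤ C(α₀,λ)`. Similarly, since `π_ε ∈ L^{3/2}(0,T;L^{3/2}(B₁))` with
> uniformly bounded norms, it follows that `π ∈ L^{3/2}(0,T;L^{3/2}(B₁))`." (p. 10)

([BT1] = Bradshaw–Tsai, Ann. Henri Poincaré 18 (2017), proof of Thm 2.4: "`U_{ε_k} → U` weakly
in `L²(0,T;X)`, … `U_{ε_k}(s) → U(s)` weakly in `L²` for all `s ∈ [0,T]`", "`p_{ε_k} → p` weakly
in `L^{5/3}(ℝ³ × [0,T])`", in the similarity variables over one period; §4: `v = u(y,s)/√(2t)`,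
`π = p(y,s)/(2t)`.) This file

* vendors `bradshawTsai2019_prop_3_1_approximation`: the scheme fact with clause (iv) replaced
  by these **printed convergence statements** — `v_ε(t) ⇀ v(t)` weakly in `L²(B_R)` for every
  `t > 0`; `∇v_ε ⇀ ∇v` weakly in `L²((t₁,t₂) × B_R)` for `0 < t₁ < t₂`; `π_ε ⇀ π` weakly in
  `L^{5/3}((t₁,t₂) × B_R)` — each rendered by convergence of the pairings against the dual space
  together with membership of all terms and of the limit (not proved here);
* **proves** the passage to the limit of p. 10,
  `bradshawTsai2019_prop_3_1_scheme_of_approximation :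
    bradshawTsai2019_prop_3_1_approximation → bradshawTsai2019_prop_3_1_scheme`:
  the weak lower semicontinuity of the three functionals (the accepted function-level lemmas of
  `FunctionSpaces/WeakLimitLpBounds`: a uniform `L²` bound passes to weak `L²` limits — for the
  velocity slices, and columnwise for the gradients, `|∇v|² = ∑ᵢ |∂ᵢv|²`; a uniform `L^{3/2}` bound
  passes to weak `L^{5/3}` limits on the finite-measure cylinders `(t₁,T) × B₁`) and the
  exhaustion `(0,T) × B₁ = ⋃ₖ (T/(k+2), T) × B₁` ("letting `k → ∞`": continuity of the lower
  Lebesgue integral along increasing unions, `setLIntegral_iUnion_of_directed`);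
* assembles `bradshawTsai2019_prop_3_1_dss_of_approximation` and
  `bradshawTsai2019_prop_3_1_of_approximation`.

Hence the trust base of Prop. 3.1 in the tree is the single fact
`bradshawTsai2019_prop_3_1_approximation`, whose remaining content is (a) the construction of
[BT1] (Thm 1.2 via Thm 2.4) *together with its approximants and their convergence* and (b) the
a priori estimate (3.12) with the pressure bound for the smooth approximants ((3.6)–(3.11):
Gagliardo–Nirenberg, Young, Calderón–Zygmund, the pressure formula (3.8)).

## Design notes

* *Sets.* "All compact `K ⊂ ℝ³`" is rendered by the balls `B_R = ball 0 R`, `R > 0` (every compact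
  set lies in some `B_R`, and `B_R ⊂ B̄_R` compact with `∂B_R` Lebesgue-null, so the two families
  give the same convergence notions); this matches the cylinders `Ioo t₁ t₂ ×ˢ ball 0 R` of the
  sibling files. Time ranges: the slices at every `t > 0` (print: "for all `s ∈ [0,T]`"; at
  `t = 0` all fields equal `v₀`), the space–time statements on `(t₁,t₂)` with `0 < t₁` — what
  [BT1]'s convergence over one period gives on every compact subinterval of `(0,∞)` by the
  `λ`-DSS scaling, and exactly what p. 10 consumes ("`L²(1/k,T;H¹(B₁))` for every `k`"); the
  extension down to `t = 0` is the proved exhaustion.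
* *Weak convergence* in `L²(S; ℝ³)` is convergence of `∫_S ⟪f_k, φ⟫` for every `φ ∈ L²(S; ℝ³)`
  (`MemLp φ 2 (volume.restrict S)`), with `f_k`, `f` in `L²(S)`; of the printed
  "weakly in `L²(0,T;H¹(K))`" only the gradient part is recorded (the part consumed), columnwise:
  `∂ₐv_ε ⇀ ∂ₐv` in `L²((t₁,t₂) × B_R; ℝ³)` for every direction `a` (equivalent to weak convergence
  of `∇v_ε` in `L²` with the Frobenius pairing). Weak convergence in `L^{5/3}(S)` of the pressures
  is convergence of `∫_S π_k ψ` for every `ψ ∈ L^{5/2}(S)` (the dual exponent), as in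
  `bradshawTsai2019_cylinderLimit` (`ForwardDSSCylinderLimit`, there with `(3/2, 3)`).
* *Which printed properties are recorded* — as in `ForwardDSSLocalEnergy` ("Which properties of
  the scheme are recorded"): clauses (i)–(iii) of the scheme fact verbatim (continuity of `α_ε`
  and its initial value, the weak gradients, (3.12), the pressure bound) and the three
  convergences above; the strong `L²(0,T;L²(K))` convergence and the weak convergence of the
  velocities themselves in `L²(0,T;H¹(K))` are not consumed by the proof of Prop. 3.1 and are
  omitted (an existential statement weaker than the printed one).

## References

* Z. Bradshaw, T.-P. Tsai, *Discretely self-similar solutions to the Navier–Stokes equations with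
  data in `L²_loc` satisfying the local energy inequality*, Analysis & PDE 12 (2019) 1943–1962 =
  arXiv:1801.08060, §3: Prop. 3.1, the convergence list on p. 8, (3.12)–(3.14) and the closing
  paragraph of the proof (p. 10) [BradshawTsai2019].
* Z. Bradshaw, T.-P. Tsai, *Forward discretely self-similar solutions of the Navier–Stokes
  equations II*, Ann. Henri Poincaré 18 (2017) 1095–1119 = arXiv:1510.07504: proof of Thm 2.4
  (the sequence `ε_k → 0` and its convergences, the weak `L^{5/3}` convergence of the pressures),
  §4 [BradshawTsai2017AHP].
* H. Brezis, *Functional Analysis, Sobolev Spaces and PDE* (2011), Prop. 3.5 (iii) [Brezis2011].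
-/

noncomputable section

open MeasureTheory Set Function Filter Topology TopologicalSpace Metric
open scoped NNReal ENNReal RealInnerProductSpace

namespace Literature.Analysis.FluidPDE

/-- Local notation for physical space `ℝ³ = EuclideanSpace ℝ (Fin 3)`. -/
local notation "ℝ³" => EuclideanSpace ℝ (Fin 3)

open BradshawTsai2019 FunctionSpaces

namespace BradshawTsai2019

/-! ## Two pieces of bookkeeping -/

/-- **"Letting `k → ∞`"** (arXiv:1801.08060, p. 10): a bound for `∫∫_{(t₁,T) × S} F` valid for
every `0 < t₁ < T` gives the same bound on `(0,T) × S`, by the exhaustion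
`(0,T) = ⋃ₖ (T/(k+2), T)` and the continuity of the lower Lebesgue integral along increasing
unions. [folklore] -/
theorem setLIntegral_Ioo_prod_le_of_forall {F : ℝ × ℝ³ → ℝ≥0∞} {T : ℝ} (hT : 0 < T)
    {S : Set ℝ³} {B : ℝ≥0∞} (h : ∀ t₁ ∈ Ioo 0 T, ∫⁻ z in Ioo t₁ T ×ˢ S, F z ≤ B) :
    ∫⁻ z in Ioo 0 T ×ˢ S, F z ≤ B := by
  set s : ℕ → Set (ℝ × ℝ³) := fun k => Ioo (T / (k + 2)) T ×ˢ S with hs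
  have hanti : ∀ {k l : ℕ}, k ≤ l → T / (l + 2) ≤ T / (k + 2) := fun {k l} hkl =>
    div_le_div_of_nonneg_left hT.le (by positivity) (by
      have hkl' : (k : ℝ) ≤ l := by exact_mod_cast hkl
      linarith)
  have hmono : Monotone s := fun k l hkl =>
    Set.prod_mono (Ioo_subset_Ioo (hanti hkl) le_rfl) Subset.rfl
  have hU : Ioo 0 T ×ˢ S = ⋃ k, s k := by
    rw [hs, ← iUnion_prod_const]
    congr 1
    ext t
    simp only [mem_Ioo, mem_iUnion]
    constructor
    · rintro ⟨ht0, htT⟩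
      obtain ⟨k, hk⟩ := exists_nat_gt (T / t)
      refine ⟨k, ?_, htT⟩
      rw [div_lt_iff₀ (by positivity)]
      have h1 : T / t < k + 2 := hk.trans (by linarith)
      rw [div_lt_iff₀ ht0] at h1
      linarith
    · rintro ⟨k, hk, htT⟩
      exact ⟨(div_pos hT (by positivity)).trans hk, htT⟩
  rw [hU, setLIntegral_iUnion_of_directed _ hmono.directed_le]
  refine iSup_le fun k => h _ ⟨div_pos hT (by positivity), ?_⟩
  rw [div_lt_iff₀ (by positivity)]
  nlinarith

/-- The dissipation density is the sum of the squared columns of the gradient: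
`|L|² = ∑ᵢ ‖L eᵢ‖²` in `ℝ≥0∞` over the standard orthonormal basis (natural-power form of
`FluidPDE.ofReal_frobeniusNormSq_eq_sum` of `NSWeakStrongUniquenessProofs`, which is stated with
the real power `2` and is not imported here). [folklore] -/
theorem ofReal_frobeniusNormSq_eq_sum_enorm_sq (L : ℝ³ →L[ℝ] ℝ³) :
    ENNReal.ofReal (frobeniusNormSq L) =
      ∑ i, ‖L (stdOrthonormalBasis ℝ ℝ³ i)‖ₑ ^ 2 := by
  rw [frobeniusNormSq, ENNReal.ofReal_sum_of_nonneg fun i _ => sq_nonneg _]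
  refine Finset.sum_congr rfl fun i _ => ?_
  rw [ENNReal.ofReal_pow (norm_nonneg _), ofReal_norm]

/-- The cylinders `(t₁,t₂) × B_R` have finite Lebesgue measure. [folklore] -/
theorem volume_Ioo_prod_ball_lt_top (t₁ t₂ R : ℝ) :
    volume (Ioo t₁ t₂ ×ˢ ball (0 : ℝ³) R) < ⊤ :=
  (measure_mono (Set.prod_mono Ioo_subset_Icc_self ball_subset_closedBall)).trans_lt
    ((isCompact_Icc.prod (isCompact_closedBall _ _)).measure_lt_top)

end BradshawTsai2019

/-! ## The analytic input with the printed convergence statements -/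

/-- **Bradshaw–Tsai 2019, §3, proof of Proposition 3.1: [BT1]'s mollified scheme with the
estimate (3.12), the pressure bound, and the convergence of the scheme** (arXiv:1801.08060,
pp. 8–10; [BT1] = Bradshaw–Tsai 2017, Thm 1.2, proof of Thm 2.4, §4). Fix `λ > 1`. There is
`C₀ = C(λ, η, γ)` such that for every divergence free `λ`-DSS `v₀ ∈ L³_w(ℝ³)`: "`v` is a `λ`-DSS
local Leray solution evolving from `v₀` constructed in [BT1] … and `π` is its associated
pressure" (`π(x,t) = p(y,s)/(2t)`, [BT1] §4, a `λ`-DSS pressure), `∇v` its weak gradient on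
`(0,∞) × ℝ³`, and "it is the limit of a mollified approximation scheme": there are `v_ε`, `π_ε`,
`∇v_ε` (`ε = ε_k → 0`) with, writing `α_ε(t) = ∫_{B₁}|v_ε(t)|²`, `α̃_ε(t) = sup_{0≤τ≤t} α_ε(τ)`,
`α₀ = ‖v₀‖²_{L²(B_λ)}`:
(i) "`α_ε(t)` and `α̃_ε(t)` are continuous as functions of `t`", "`v_ε(t) → v₀` in `L²_loc`" (p. 8);
(ii) **(3.12)** "`α_ε(t) + ∫₀ᵗ∫_{B₁}|∇v_ε|² ≤ α₀ + C(λ,η,γ)∫₀ᵗ(α̃_ε(s)³ + α̃_ε(s)) ds`", `0 < t ≤ 1`;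
(iii) the pressure bound `∫₀ᵗ∫_{B₁}|π_ε|^{3/2} ≤ C₀(α₀ + ∫₀ᵗ(α̃_ε³ + α̃_ε) ds)`, `0 < t ≤ 1` (the three
`L^{3/2}(0,t;L^{3/2}(B_λ))` bounds of p. 10 with the absorption step of (3.12));
(iv) the convergence of the scheme (p. 8: "By the convergence properties of `u_ε(y,s)` to
`u(y,s) = √t v(x,t)` [BT1] and discretely self-similar scaling … for all `T > 0` and all compact
sets `K ⊂ ℝ³`, `v_ε → v` weakly in `L²(0,T;H¹(K))`, … `v_ε(s) → v(s)` weakly in `L²(K)` for all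
`s ∈ [0,T]`"; p. 10: "`v_ε` converges weakly to `v` in `L²(1/k,T;H¹(B₁))` for every `k ∈ ℕ`";
[BT1] proof of Thm 2.4: "`p_{ε_k} → p` weakly in `L^{5/3}(ℝ³ × [0,T])`" over one period, whence
on every `(t₁,t₂) ⊂ (0,∞)` by the scaling): `v_ε(t) ⇀ v(t)` weakly in `L²(B_R)` for every
`t > 0`; `∂ₐv_ε ⇀ ∂ₐv` weakly in `L²((t₁,t₂) × B_R)` for every direction `a`, `0 < t₁ < t₂`;
`π_ε ⇀ π` weakly in `L^{5/3}((t₁,t₂) × B_R)`, `0 < t₁ < t₂` — pairings against the dual space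
converge, all terms and the limit lying in the space. See the module docstring ("Which printed
properties are recorded", "Sets") for what is kept. With the proved passage to the limit this
gives `bradshawTsai2019_prop_3_1_scheme` (`bradshawTsai2019_prop_3_1_scheme_of_approximation`).
**Not proved here.** [cite: BradshawTsai2019, §3 proof of Prop 3.1 (p. 8 convergence list, (3.5)–(3.12)); BradshawTsai2017AHP proof of Thm 2.4] -/
def bradshawTsai2019_prop_3_1_approximation : Prop :=
  ∀ {c : ℝ}, 1 < c → ∃ C₀ : ℝ≥0, ∀ {v₀ : ℝ³ → ℝ³},
    FunctionSpaces.MemWeakLp v₀ 3 volume → IsWeaklyDivFree v₀ → nsRescaleData c v₀ = v₀ →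
    ∃ (v : ℝ → ℝ³ → ℝ³) (π : ℝ → ℝ³ → ℝ) (G : ℝ → ℝ³ → ℝ³ →L[ℝ] ℝ³),
      -- the [BT1] solution, its pressure and its gradient
      IsLocalLeraySolution 1 v₀ v π ∧ IsDiscretelySelfSimilar c v ∧ nsRescalePressure c π = π ∧
      HasWeakSpatialGradientOn (slab ℝ³ (Ioi 0) isOpen_Ioi) v G ∧
      -- the mollified approximants `v_ε`, `π_ε`, `∇v_ε`, `ε = ε_k → 0`
      ∃ (w : ℕ → ℝ → ℝ³ → ℝ³) (ϖ : ℕ → ℝ → ℝ³ → ℝ) (H : ℕ → ℝ → ℝ³ → ℝ³ →L[ℝ] ℝ³),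
        -- (i) continuity of `α_ε` on `(0, ∞)` and its right limit `∫_{B₁}|v₀|²` at `t = 0`
        (∀ k, ContinuousOn (ballEnergy (w k)) (Ioi 0)) ∧
        (∀ k, Tendsto (ballEnergy (w k)) (𝓝[>] 0) (𝓝 (∫⁻ x in ball (0 : ℝ³) 1, ‖v₀ x‖ₑ ^ 2))) ∧
        (∀ k, HasWeakSpatialGradientOn (slab ℝ³ (Ioi 0) isOpen_Ioi) (w k) (H k)) ∧
        -- (ii) the local energy inequality (3.12), `0 < t ≤ 1`
        (∀ k, ∀ t : ℝ, 0 < t → t ≤ 1 →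
          ballEnergy (w k) t +
              ∫⁻ z in Ioo 0 t ×ˢ ball (0 : ℝ³) 1, ENNReal.ofReal (frobeniusNormSq (H k z.1 z.2)) ≤
            (∫⁻ x in ball (0 : ℝ³) c, ‖v₀ x‖ₑ ^ 2) +
              C₀ * ∫⁻ s in Ioo 0 t, (supBallEnergy (w k) s ^ 3 + supBallEnergy (w k) s)) ∧
        -- (iii) the pressure bound, `0 < t ≤ 1`
        (∀ k, ∀ t : ℝ, 0 < t → t ≤ 1 →
          ∫⁻ z in Ioo 0 t ×ˢ ball (0 : ℝ³) 1, ‖ϖ k z.1 z.2‖ₑ ^ (3 / 2 : ℝ) ≤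
            C₀ * ((∫⁻ x in ball (0 : ℝ³) c, ‖v₀ x‖ₑ ^ 2) +
              ∫⁻ s in Ioo 0 t, (supBallEnergy (w k) s ^ 3 + supBallEnergy (w k) s))) ∧
        -- (iv) the convergence of the scheme:
        -- `v_ε(t) ⇀ v(t)` weakly in `L²(B_R)` for every `t > 0`, `R > 0`
        (∀ t : ℝ, 0 < t → ∀ R : ℝ, 0 < R →
          MemLp (v t) 2 (volume.restrict (ball (0 : ℝ³) R)) ∧
          (∀ k, MemLp (w k t) 2 (volume.restrict (ball (0 : ℝ³) R))) ∧
          ∀ φ : ℝ³ → ℝ³, MemLp φ 2 (volume.restrict (ball (0 : ℝ³) R)) →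
            Tendsto (fun k => ∫ x in ball (0 : ℝ³) R, ⟪w k t x, φ x⟫) atTop
              (𝓝 (∫ x in ball (0 : ℝ³) R, ⟪v t x, φ x⟫))) ∧
        -- `∂ₐv_ε ⇀ ∂ₐv` weakly in `L²((t₁,t₂) × B_R)`, `0 < t₁ < t₂`, `R > 0`, every direction `a`
        (∀ t₁ t₂ R : ℝ, 0 < t₁ → t₁ < t₂ → 0 < R → ∀ a : ℝ³,
          MemLp (fun z : ℝ × ℝ³ => G z.1 z.2 a) 2
            (volume.restrict (Ioo t₁ t₂ ×ˢ ball (0 : ℝ³) R)) ∧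
          (∀ k, MemLp (fun z : ℝ × ℝ³ => H k z.1 z.2 a) 2
            (volume.restrict (Ioo t₁ t₂ ×ˢ ball (0 : ℝ³) R))) ∧
          ∀ φ : ℝ × ℝ³ → ℝ³, MemLp φ 2 (volume.restrict (Ioo t₁ t₂ ×ˢ ball (0 : ℝ³) R)) →
            Tendsto (fun k => ∫ z in Ioo t₁ t₂ ×ˢ ball (0 : ℝ³) R, ⟪H k z.1 z.2 a, φ z⟫) atTop
              (𝓝 (∫ z in Ioo t₁ t₂ ×ˢ ball (0 : ℝ³) R, ⟪G z.1 z.2 a, φ z⟫))) ∧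
        -- `π_ε ⇀ π` weakly in `L^{5/3}((t₁,t₂) × B_R)`, `0 < t₁ < t₂`, `R > 0`
        (∀ t₁ t₂ R : ℝ, 0 < t₁ → t₁ < t₂ → 0 < R →
          MemLp (fun z : ℝ × ℝ³ => π z.1 z.2) (5 / 3 : ℝ≥0∞)
            (volume.restrict (Ioo t₁ t₂ ×ˢ ball (0 : ℝ³) R)) ∧
          (∀ k, MemLp (fun z : ℝ × ℝ³ => ϖ k z.1 z.2) (5 / 3 : ℝ≥0∞)
            (volume.restrict (Ioo t₁ t₂ ×ˢ ball (0 : ℝ³) R))) ∧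
          ∀ ψ : ℝ × ℝ³ → ℝ, MemLp ψ (5 / 2 : ℝ≥0∞) (volume.restrict (Ioo t₁ t₂ ×ˢ ball (0 : ℝ³) R)) →
            Tendsto (fun k => ∫ z in Ioo t₁ t₂ ×ˢ ball (0 : ℝ³) R, ϖ k z.1 z.2 * ψ z) atTop
              (𝓝 (∫ z in Ioo t₁ t₂ ×ˢ ball (0 : ℝ³) R, π z.1 z.2 * ψ z)))

/-! ## The passage to the limit: approximation ⟹ scheme -/

/-- **Bradshaw–Tsai 2019, proof of Prop. 3.1, the passage to the limit `ε → 0`** (arXiv p. 10),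
proved: the convergence statements of `bradshawTsai2019_prop_3_1_approximation` imply clause (iv)
of `bradshawTsai2019_prop_3_1_scheme` — a bound obeyed by all approximants on `(0,T] × B₁` is
obeyed by the limit. Sliced energy: "`(v, χ_{B₁}v)(t) ≤ liminf_{ε→0} (v_ε, χ_{B₁}v_ε)_{L²}(t)`" at
every `t ∈ (0,T)` (weak lower semicontinuity in `L²(B₁)`,
`FunctionSpaces.lintegral_enorm_sq_le_of_tendsto_integral_inner`). Dissipation:
"`∫_{1/k}^T∫_{B₁}|∇v|² ≤ sup_{ε>0}∫₀ᵀ∫_{B₁}|∇v_ε|²` … letting `k → ∞`" (columnwise weak lower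
semicontinuity in `L²((t₁,T) × B₁)`, `|∇v|² = ∑ᵢ|∂ᵢv|²`,
`FunctionSpaces.sum_lintegral_enorm_sq_le_of_tendsto_integral_inner`, then the exhaustion
`BradshawTsai2019.setLIntegral_Ioo_prod_le_of_forall`). Pressure: "since
`π_ε ∈ L^{3/2}(0,T;L^{3/2}(B₁))` with uniformly bounded norms, it follows that
`π ∈ L^{3/2}(0,T;L^{3/2}(B₁))`" (a uniform `L^{3/2}` bound passes to weak `L^{5/3}` limits on the
finite-measure cylinder `(t₁,T) × B₁`,
`FunctionSpaces.lintegral_enorm_rpow_three_halves_le_of_tendsto_integral_mul`, then the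
exhaustion). [cite: BradshawTsai2019, proof of Prop 3.1 (p. 10, "Letting ε → 0 …")] -/
theorem bradshawTsai2019_prop_3_1_scheme_of_approximation
    (h : bradshawTsai2019_prop_3_1_approximation) : bradshawTsai2019_prop_3_1_scheme := by
  intro c hc
  obtain ⟨C₀, hC₀⟩ := h hc
  refine ⟨C₀, fun {v₀} hw hdiv hdss => ?_⟩
  obtain ⟨v, π, G, hLL, hdssv, hdssπ, hG, w, ϖ, H, hcont, hlim0, hH, hen, hpr, hslice, hgrad,
    hpress⟩ := hC₀ hw hdiv hdss
  refine ⟨v, π, G, hLL, hdssv, hdssπ, hG, w, ϖ, H, hcont, hlim0, hH, hen, hpr, ?_, ?_, ?_⟩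
  · -- sliced energy: weak lower semicontinuity in `L²(B₁)` at every `t ∈ (0, T)`
    intro T _ B hB
    rw [ae_restrict_iff' measurableSet_Ioo]
    refine ae_of_all _ fun t ht => ?_
    obtain ⟨hv2, hw2, hweak⟩ := hslice t ht.1 1 one_pos
    exact lintegral_enorm_sq_le_of_tendsto_integral_inner (μ := volume.restrict (ball (0 : ℝ³) 1))
      (fun k => (hw2 k).1) hv2 (hweak _ hv2) fun k => hB k t ⟨ht.1, ht.2.le⟩
  · -- dissipation: columnwise weak lower semicontinuity on `(t₁, T) × B₁`, then `t₁ → 0`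
    intro T hT B hB
    refine setLIntegral_Ioo_prod_le_of_forall hT fun t₁ ht₁ => ?_
    set S : Set (ℝ × ℝ³) := Ioo t₁ T ×ˢ ball (0 : ℝ³) 1 with hS
    set μ : Measure (ℝ × ℝ³) := volume.restrict S with hμ
    set e := stdOrthonormalBasis ℝ ℝ³ with he
    have hcol := fun a : ℝ³ => hgrad t₁ T 1 ht₁.1 ht₁.2 one_pos a
    -- rewrite both dissipations as sums over the columns
    have hGsum : ∫⁻ z in S, ENNReal.ofReal (frobeniusNormSq (G z.1 z.2)) =
        ∑ i, ∫⁻ z, ‖G z.1 z.2 (e i)‖ₑ ^ 2 ∂μ := by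
      rw [← lintegral_finsetSum' _ fun i _ =>
        ((hcol (e i)).1.1.enorm.pow_const 2)]
      exact lintegral_congr fun z => ofReal_frobeniusNormSq_eq_sum_enorm_sq _
    have hHsum : ∀ k, ∑ i, ∫⁻ z, ‖H k z.1 z.2 (e i)‖ₑ ^ 2 ∂μ =
        ∫⁻ z in S, ENNReal.ofReal (frobeniusNormSq (H k z.1 z.2)) := fun k => by
      rw [← lintegral_finsetSum' _ fun i _ =>
        (((hcol (e i)).2.1 k).1.enorm.pow_const 2)]
      exact lintegral_congr fun z => (ofReal_frobeniusNormSq_eq_sum_enorm_sq _).symm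
    rw [hGsum]
    refine sum_lintegral_enorm_sq_le_of_tendsto_integral_inner (μ := μ)
      (f := fun k i z => H k z.1 z.2 (e i)) (g := fun i z => G z.1 z.2 (e i))
      (fun k i => ((hcol (e i)).2.1 k).1) (fun i => (hcol (e i)).1)
      (tendsto_finsetSum _ fun i _ => (hcol (e i)).2.2 _ (hcol (e i)).1) fun k => ?_
    rw [hHsum k]
    exact (lintegral_mono_set (Set.prod_mono (Ioo_subset_Ioo ht₁.1.le le_rfl) Subset.rfl)).trans (hB k)
  · -- pressure: a uniform `L^{3/2}` bound passes to the weak `L^{5/3}` limit on `(t₁, T) × B₁`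
    intro T hT B hB
    refine setLIntegral_Ioo_prod_le_of_forall hT fun t₁ ht₁ => ?_
    set S : Set (ℝ × ℝ³) := Ioo t₁ T ×ˢ ball (0 : ℝ³) 1 with hS
    haveI : IsFiniteMeasure (volume.restrict S) :=
      ⟨by rw [Measure.restrict_apply_univ]; exact volume_Ioo_prod_ball_lt_top _ _ _⟩
    obtain ⟨hπ, hϖ, hweak⟩ := hpress t₁ T 1 ht₁.1 ht₁.2 one_pos
    exact lintegral_enorm_rpow_three_halves_le_of_tendsto_integral_mul
      (μ := volume.restrict S) (f := fun k z => ϖ k z.1 z.2) (g := fun z => π z.1 z.2)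
      (fun k => (hϖ k).1) hπ hweak fun k =>
        (lintegral_mono_set (Set.prod_mono (Ioo_subset_Ioo ht₁.1.le le_rfl) Subset.rfl)).trans (hB k)

/-! ## The assembly down to Proposition 3.1 -/

/-- **Prop. 3.1 with the DSS pressure clause from the approximation fact**: the passage to the
limit (this file), the continuity argument and the bookkeeping with `T(α₀,λ)`, `C(α₀,λ)`
(`ForwardDSSLocalEnergy`). [cite: BradshawTsai2019, Prop 3.1 (proof pp. 8–10)] -/
theorem bradshawTsai2019_prop_3_1_dss_of_approximation
    (h : bradshawTsai2019_prop_3_1_approximation) : bradshawTsai2019_prop_3_1_dss :=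
  bradshawTsai2019_prop_3_1_dss_of_scheme (bradshawTsai2019_prop_3_1_scheme_of_approximation h)

/-- **Prop. 3.1 as rendered in `ForwardDSSExistence.lean` from the approximation fact.** Hence
the trust base of `bradshawTsai2019_prop_3_1` is `{bradshawTsai2019_prop_3_1_approximation}`:
[BT1]'s construction with its approximants and their convergence, and the a priori estimate
(3.12) with the pressure bound. [cite: BradshawTsai2019, Prop 3.1 (proof pp. 8–10)] -/
theorem bradshawTsai2019_prop_3_1_of_approximation
    (h : bradshawTsai2019_prop_3_1_approximation) : bradshawTsai2019_prop_3_1 :=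
  bradshawTsai2019_prop_3_1_of_scheme (bradshawTsai2019_prop_3_1_scheme_of_approximation h)

end Literature.Analysis.FluidPDE

end
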